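import Mathlib.AlgebraicTopology.FundamentalGroupoid.SimplyConnected
import Mathlib.Algebra.Group.Subgroup.MulOppositeLemmas
import Literature.AlgebraicTopology.FundamentalGroup.MonodromyNaturality
import Literature.AlgebraicTopology.FundamentalGroup.MapOfEqRange
import Literature.AlgebraicTopology.SingularHomology.LoopClassesSpan
import Literature.AlgebraicTopology.SingularHomology.KroneckerDualMap
import HarnessLib

/-!
# A map covered by an equivariant lift between quotient coverings: its range on `π₁`, surjectivity, and injectivity on `H¹`

Topic `Literature/AlgebraicTopology/FundamentalGroup`; sequel of `MonodromyNaturality.lean` (naturality of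
the monodromy `π₁(X, x) → Gᵐᵒᵖ` of a quotient covering under equivariant lifts) and of Mathlib's
`IsQuotientCoveringMap.fundamentalGroupEquiv` (`π₁(X, x) ≅ Gᵐᵒᵖ` when the total space is simply
connected, J. Xu).  THEOREMS ONLY (one private index lemma), no definition, no named fact.

Setting (Hatcher, *Algebraic Topology*, §1.3, Prop. 1.39 / 1.40 and the lifting criterion 1.33): two
quotient covering maps `p : E → X = E/G` and `p' : E' → X' = E'/G'` (free, properly discontinuous
actions), a continuous `φ : X → X'` and a continuous LIFT `φ̃ : E → E'` over it (`p' ∘ φ̃ = φ ∘ p`) which is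
`τ`-EQUIVARIANT for a map `τ : G → G'` (`φ̃ (g • z) = τ g • φ̃ z`).  Then, on fundamental groups,
"`φ_*` is `τ`": precisely

* `surjective_mapOfEq_of_equivariant` — **if `E` is path connected, `E'` is simply connected and `τ` is
  ONTO, then `φ_* : π₁(X, p e) → π₁(X', p' (φ̃ e))` is onto** (given `δ`, read off its monodromy
  `g' ∈ G'`, choose `g ↦ g'` and a class `γ` upstairs-connecting `e` to `g • e`; by naturality
  `φ_* γ` and `δ` have the same monodromy, and the monodromy is injective because `E'` is simply
  connected); `surjective_map_of_equivariant` (Mathlib's `FundamentalGroup.map`, base point `p e`),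
  `range_map_eq_top_of_equivariant`, `index_range_map_eq_one_of_equivariant`;
* `surjective_mapOfEq_iff_of_equivariant` — conversely `φ_*` onto forces `τ` onto, so **`φ_*` is onto
  iff `τ` is**;
* `range_mapOfEq_eq_comap_of_equivariant` — for `τ` a HOMOMORPHISM the exact statement: the range of
  `φ_*` is the preimage of `τ(G)ᵒᵖ ≤ G'ᵐᵒᵖ` under the monodromy isomorphism `π₁(X', ·) ≅ G'ᵐᵒᵖ`, hence
  `index_range_mapOfEq_eq_of_equivariant`: **`[π₁(X') : φ_* π₁(X)] = [G' : τ(G)]`**;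
* the same three surjectivity statements for ADDITIVE groups acting (`…_add`) and in the MIXED form
  (`…_vadd`: `G` multiplicative on `E`, e.g. a discrete group of automorphisms of a ball, `G'` additive on
  `E'`, e.g. a lattice acting on a vector space by translations — the shape of an Albanese / period map);
* `injective_singularCohomology_map_one_of_equivariant` (+ `_vadd`) — consequently, over a field `F` of
  characteristic zero, **`φ^* : H¹(X'; F) → H¹(X; F)` is injective** (the tree's
  `singularHomology.map_one_surjective_of_index_ne_zero`, Hatcher Thm. 2A.1, and Kronecker duality
  `singularCohomology_map_injective_iff_of_field`).

Use (cell `pub-hodgecm2`, plan ALB-H1-ISO step S7): for a compact ball quotient `X = Γ \ 𝔹²`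
(`isQuotientCoveringMap_ballUnifMap`) and its period map `𝔹² → V`, `z ↦ ∫_{z₀}^{z} ω⃗`, equivariant for
the period homomorphism `Γ → Λ ⊂ V` (onto the period lattice `Λ` by definition), the Albanese map
`X → V/Λ` is onto on `π₁`, hence injective on `H¹(·; ℚ)`.

## References

* [HatcherAT2002] A. Hatcher, *Algebraic Topology*, CUP 2002: Prop. 1.33, Prop. 1.39, Prop. 1.40,
  Thm. 2A.1, §3.1 p. 198.
-/

noncomputable section

open Function MulOpposite

universe u v

namespace Literature.AlgebraicTopology.FundamentalGroup

open IsQuotientCoveringMap Literature.AlgebraicTopology.SingularHomology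

/-! ### An index book-keeping lemma: `[Gᵐᵒᵖ : Hᵒᵖ] = [G : H]` -/

/-- Left cosets of `Hᵒᵖ` in `Gᵐᵒᵖ` are right cosets of `H` in `G`, which are as many as left cosets:
`Hᵒᵖ.index = H.index`. [folklore] -/
private theorem index_op_eq_index {G : Type*} [Group G] (H : Subgroup G) : H.op.index = H.index := by
  classical
  -- `Gᵐᵒᵖ ⧸ Hᵒᵖ ≃ Quotient (rightRel H) ≃ G ⧸ H`
  have key : ∀ a b : G, QuotientGroup.leftRel H.op (op a) (op b) ↔ QuotientGroup.rightRel H a b := by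
    intro a b
    rw [QuotientGroup.leftRel_apply, QuotientGroup.rightRel_apply, Subgroup.mem_op, ← op_inv, ← op_mul,
      unop_op]
  let e₁ : Gᵐᵒᵖ ⧸ H.op ≃ Quotient (QuotientGroup.rightRel H) :=
    Quotient.congr MulOpposite.opEquiv.symm (fun x y ↦ by
      induction x using MulOpposite.rec' with | h a =>
      induction y using MulOpposite.rec' with | h b =>
      change QuotientGroup.leftRel H.op (op a) (op b) ↔ QuotientGroup.rightRel H a b
      exact key a b)
  have e₂ : Quotient (QuotientGroup.rightRel H) ≃ G ⧸ H :=
    QuotientGroup.quotientRightRelEquivQuotientLeftRel H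
  rw [Subgroup.index, Subgroup.index]
  exact Nat.card_congr (e₁.trans e₂)

/-! ### Multiplicative actions on both sides -/

section MulMul

variable {E X E' X' : Type*} [TopologicalSpace E] [TopologicalSpace X] [TopologicalSpace E']
  [TopologicalSpace X'] {G G' : Type*} [Group G] [MulAction G E] [Group G'] [MulAction G' E']
  {p : E → X} {p' : E' → X'}

/-- **A map covered by a `τ`-equivariant lift with `τ` onto is onto on `π₁`** (total space upstairs
path connected, downstairs-target simply connected): for every `δ ∈ π₁(X', p' e')` pick `g` with
`τ g` = the monodromy of `δ`, then a class `γ ∈ π₁(X, p e)` of monodromy `g` (a path from `e` to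
`g • e` pushed down); `φ_* γ` has the monodromy of `δ` (naturality, `fundamentalGroupToMulOpposite_mapOfEq`)
and the monodromy `π₁(X', p' e') → G'ᵐᵒᵖ` is injective as `E'` is simply connected.
[cite: HatcherAT2002, Prop. 1.39 and Prop. 1.40] -/
theorem surjective_mapOfEq_of_equivariant [PathConnectedSpace E] [SimplyConnectedSpace E']
    (hp : IsQuotientCoveringMap p G) (hp' : IsQuotientCoveringMap p' G') (φt : C(E, E')) (φ : C(X, X'))
    (τ : G → G') (hτ : Surjective τ) (hover : ∀ z, p' (φt z) = φ (p z))
    (hequiv : ∀ (g : G) (z : E), φt (g • z) = τ g • φt z) (e : E) {e' : E'} (he : φt e = e') :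
    Surjective (FundamentalGroup.mapOfEq φ (show φ (p e) = p' e' by rw [← hover, he])) := by
  intro δ
  obtain ⟨g, hg⟩ := hτ (unop (hp'.fundamentalGroupToMulOpposite ⟨e', rfl⟩ δ))
  obtain ⟨γ, hγ⟩ := hp.fundamentalGroupToMulOpposite_surjective ⟨e, rfl⟩ (op g)
  refine ⟨γ, hp'.fundamentalGroupToMulOpposite_injective ⟨e', rfl⟩ ?_⟩
  rw [fundamentalGroupToMulOpposite_mapOfEq hp hp' φt φ τ hover hequiv e he γ, hγ, unop_op, hg, op_unop]

/-- **`φ_*` is onto iff `τ` is onto** (same setting): conversely, if `φ_*` is onto then every `g' ∈ G'`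
is the monodromy of some `φ_* γ`, i.e. `τ` of the monodromy of `γ`.
[cite: HatcherAT2002, Prop. 1.39 and Prop. 1.40] -/
theorem surjective_mapOfEq_iff_of_equivariant [PathConnectedSpace E] [SimplyConnectedSpace E']
    (hp : IsQuotientCoveringMap p G) (hp' : IsQuotientCoveringMap p' G') (φt : C(E, E')) (φ : C(X, X'))
    (τ : G → G') (hover : ∀ z, p' (φt z) = φ (p z))
    (hequiv : ∀ (g : G) (z : E), φt (g • z) = τ g • φt z) (e : E) {e' : E'} (he : φt e = e') :
    Surjective (FundamentalGroup.mapOfEq φ (show φ (p e) = p' e' by rw [← hover, he])) ↔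
      Surjective τ := by
  refine ⟨fun hφ g' ↦ ?_, fun hτ ↦ surjective_mapOfEq_of_equivariant hp hp' φt φ τ hτ hover hequiv e he⟩
  haveI : PathConnectedSpace E' := inferInstance
  obtain ⟨δ, hδ⟩ := hp'.fundamentalGroupToMulOpposite_surjective ⟨e', rfl⟩ (op g')
  obtain ⟨γ, rfl⟩ := hφ δ
  refine ⟨unop (hp.fundamentalGroupToMulOpposite ⟨e, rfl⟩ γ), ?_⟩
  have h := fundamentalGroupToMulOpposite_mapOfEq hp hp' φt φ τ hover hequiv e he γ
  rw [hδ] at h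
  exact (op_injective h).symm

/-- Base point `p e` / `φ (p e)` form with Mathlib's `FundamentalGroup.map`: **`φ_* : π₁(X, p e) →
π₁(X', φ (p e))` is onto** when `τ` is. [cite: HatcherAT2002, Prop. 1.39 and Prop. 1.40] -/
theorem surjective_map_of_equivariant [PathConnectedSpace E] [SimplyConnectedSpace E']
    (hp : IsQuotientCoveringMap p G) (hp' : IsQuotientCoveringMap p' G') (φt : C(E, E')) (φ : C(X, X'))
    (τ : G → G') (hτ : Surjective τ) (hover : ∀ z, p' (φt z) = φ (p z))
    (hequiv : ∀ (g : G) (z : E), φt (g • z) = τ g • φt z) (e : E) :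
    Surjective (FundamentalGroup.map φ (p e)) := by
  -- transport the base point `p' (φ̃ e)` to `φ (p e)` along `hover e`
  have hs := surjective_mapOfEq_of_equivariant hp hp' φt φ τ hτ hover hequiv e rfl
  have key : ∀ {y : X'} (h : φ (p e) = y), Surjective (FundamentalGroup.mapOfEq φ h) →
      Surjective (FundamentalGroup.map φ (p e)) := by
    intro y h hsurj
    subst h
    intro δ
    obtain ⟨γ, hγ⟩ := hsurj δ
    exact ⟨γ, by rw [← mapOfEq_rfl_apply, hγ]⟩
  exact key _ hs

/-- Range form: `φ_* π₁(X, p e) = π₁(X', φ (p e))`. [cite: HatcherAT2002, Prop. 1.39 and Prop. 1.40] -/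
theorem range_map_eq_top_of_equivariant [PathConnectedSpace E] [SimplyConnectedSpace E']
    (hp : IsQuotientCoveringMap p G) (hp' : IsQuotientCoveringMap p' G') (φt : C(E, E')) (φ : C(X, X'))
    (τ : G → G') (hτ : Surjective τ) (hover : ∀ z, p' (φt z) = φ (p z))
    (hequiv : ∀ (g : G) (z : E), φt (g • z) = τ g • φt z) (e : E) :
    (FundamentalGroup.map φ (p e)).range = ⊤ :=
  MonoidHom.range_eq_top.2 (surjective_map_of_equivariant hp hp' φt φ τ hτ hover hequiv e)

/-- Index form: `[π₁(X', φ (p e)) : φ_* π₁(X, p e)] = 1` (the hypothesis shape of the tree's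
`singularHomology.map_one_surjective_of_index_ne_zero` and of Mathlib's lifting criterion).
[cite: HatcherAT2002, Prop. 1.39 and Prop. 1.40] -/
theorem index_range_map_eq_one_of_equivariant [PathConnectedSpace E] [SimplyConnectedSpace E']
    (hp : IsQuotientCoveringMap p G) (hp' : IsQuotientCoveringMap p' G') (φt : C(E, E')) (φ : C(X, X'))
    (τ : G → G') (hτ : Surjective τ) (hover : ∀ z, p' (φt z) = φ (p z))
    (hequiv : ∀ (g : G) (z : E), φt (g • z) = τ g • φt z) (e : E) :
    (FundamentalGroup.map φ (p e)).range.index = 1 := by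
  rw [range_map_eq_top_of_equivariant hp hp' φt φ τ hτ hover hequiv e, Subgroup.index_top]

/-- **The range of `φ_*` for a `τ`-equivariant lift with `τ` a homomorphism**: under the monodromy
isomorphism `π₁(X', p' e') ≅ G'ᵐᵒᵖ` (Mathlib `IsQuotientCoveringMap.fundamentalGroupToMulOpposite`, bijective
as `E'` is simply connected) the image `φ_* π₁(X, p e)` corresponds to `τ(G)ᵒᵖ`: the monodromy upstairs is
onto `Gᵐᵒᵖ` (`E` path connected) and `φ_*` is `τ` on monodromies. [cite: HatcherAT2002, Prop. 1.39 and Prop. 1.40] -/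
theorem range_mapOfEq_eq_comap_of_equivariant [PathConnectedSpace E] [SimplyConnectedSpace E']
    (hp : IsQuotientCoveringMap p G) (hp' : IsQuotientCoveringMap p' G') (φt : C(E, E')) (φ : C(X, X'))
    (τ : G →* G') (hover : ∀ z, p' (φt z) = φ (p z))
    (hequiv : ∀ (g : G) (z : E), φt (g • z) = τ g • φt z) (e : E) {e' : E'} (he : φt e = e') :
    (FundamentalGroup.mapOfEq φ (show φ (p e) = p' e' by rw [← hover, he])).range =
      τ.range.op.comap (hp'.fundamentalGroupToMulOpposite ⟨e', rfl⟩) := by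
  ext δ
  simp only [MonoidHom.mem_range, Subgroup.mem_comap, Subgroup.mem_op]
  constructor
  · rintro ⟨γ, rfl⟩
    exact ⟨unop (hp.fundamentalGroupToMulOpposite ⟨e, rfl⟩ γ), by
      rw [fundamentalGroupToMulOpposite_mapOfEq hp hp' φt φ τ hover hequiv e he γ, unop_op]⟩
  · rintro ⟨g, hg⟩
    obtain ⟨γ, hγ⟩ := hp.fundamentalGroupToMulOpposite_surjective ⟨e, rfl⟩ (op g)
    refine ⟨γ, hp'.fundamentalGroupToMulOpposite_injective ⟨e', rfl⟩ ?_⟩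
    rw [fundamentalGroupToMulOpposite_mapOfEq hp hp' φt φ τ hover hequiv e he γ, hγ, unop_op, ← op_unop
      (hp'.fundamentalGroupToMulOpposite ⟨e', rfl⟩ δ), hg]

/-- **`[π₁(X') : φ_* π₁(X)] = [G' : τ(G)]`** for a `τ`-equivariant lift with `τ` a homomorphism (`E` path
connected, `E'` simply connected); in particular `φ_* π₁(X)` has finite index iff `τ(G)` has.
[cite: HatcherAT2002, Prop. 1.39 and Prop. 1.40] -/
theorem index_range_mapOfEq_eq_of_equivariant [PathConnectedSpace E] [SimplyConnectedSpace E']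
    (hp : IsQuotientCoveringMap p G) (hp' : IsQuotientCoveringMap p' G') (φt : C(E, E')) (φ : C(X, X'))
    (τ : G →* G') (hover : ∀ z, p' (φt z) = φ (p z))
    (hequiv : ∀ (g : G) (z : E), φt (g • z) = τ g • φt z) (e : E) {e' : E'} (he : φt e = e') :
    (FundamentalGroup.mapOfEq φ (show φ (p e) = p' e' by rw [← hover, he])).range.index = τ.range.index := by
  haveI : PathConnectedSpace E' := inferInstance
  rw [range_mapOfEq_eq_comap_of_equivariant hp hp' φt φ τ hover hequiv e he,
    Subgroup.index_comap_of_surjective _ (hp'.fundamentalGroupToMulOpposite_surjective ⟨e', rfl⟩),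
    index_op_eq_index]

/-- Base-point form of the index identity: `[π₁(X', φ (p e)) : (map φ (p e)) π₁(X, p e)] = [G' : τ(G)]`.
[cite: HatcherAT2002, Prop. 1.39 and Prop. 1.40] -/
theorem index_range_map_eq_of_equivariant [PathConnectedSpace E] [SimplyConnectedSpace E']
    (hp : IsQuotientCoveringMap p G) (hp' : IsQuotientCoveringMap p' G') (φt : C(E, E')) (φ : C(X, X'))
    (τ : G →* G') (hover : ∀ z, p' (φt z) = φ (p z))
    (hequiv : ∀ (g : G) (z : E), φt (g • z) = τ g • φt z) (e : E) :
    (FundamentalGroup.map φ (p e)).range.index = τ.range.index := by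
  rw [← index_range_mapOfEq (h := (hover e).symm),
    index_range_mapOfEq_eq_of_equivariant hp hp' φt φ τ hover hequiv e rfl]

end MulMul

/-! ### Additive actions on both sides -/

section AddAdd

variable {E X E' X' : Type*} [TopologicalSpace E] [TopologicalSpace X] [TopologicalSpace E']
  [TopologicalSpace X'] {G G' : Type*} [AddGroup G] [AddAction G E] [AddGroup G'] [AddAction G' E']
  {p : E → X} {p' : E' → X'}

/-- Additive version of `surjective_map_of_equivariant` (additive groups acting, e.g. lattices by
translations). [cite: HatcherAT2002, Prop. 1.39 and Prop. 1.40] -/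
theorem surjective_map_of_equivariant_add [PathConnectedSpace E] [SimplyConnectedSpace E']
    (hp : IsAddQuotientCoveringMap p G) (hp' : IsAddQuotientCoveringMap p' G') (φt : C(E, E'))
    (φ : C(X, X')) (τ : G → G') (hτ : Surjective τ) (hover : ∀ z, p' (φt z) = φ (p z))
    (hequiv : ∀ (g : G) (z : E), φt (g +ᵥ z) = τ g +ᵥ φt z) (e : E) :
    Surjective (FundamentalGroup.map φ (p e)) :=
  surjective_map_of_equivariant hp.toMultiplicative hp'.toMultiplicative φt φ
    (fun g ↦ Multiplicative.ofAdd (τ g.toAdd))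
    (fun g' ↦ by obtain ⟨g, hg⟩ := hτ g'.toAdd; exact ⟨Multiplicative.ofAdd g, by simp [hg]⟩)
    hover (fun g z ↦ hequiv g.toAdd z) e

/-- Additive version of `index_range_map_eq_one_of_equivariant`. [cite: HatcherAT2002, Prop. 1.39 and Prop. 1.40] -/
theorem index_range_map_eq_one_of_equivariant_add [PathConnectedSpace E] [SimplyConnectedSpace E']
    (hp : IsAddQuotientCoveringMap p G) (hp' : IsAddQuotientCoveringMap p' G') (φt : C(E, E'))
    (φ : C(X, X')) (τ : G → G') (hτ : Surjective τ) (hover : ∀ z, p' (φt z) = φ (p z))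
    (hequiv : ∀ (g : G) (z : E), φt (g +ᵥ z) = τ g +ᵥ φt z) (e : E) :
    (FundamentalGroup.map φ (p e)).range.index = 1 := by
  rw [MonoidHom.range_eq_top.2 (surjective_map_of_equivariant_add hp hp' φt φ τ hτ hover hequiv e),
    Subgroup.index_top]

end AddAdd

/-! ### Mixed form: a multiplicative group upstairs, an additive group on the target -/

section MulAdd

variable {E X E' X' : Type*} [TopologicalSpace E] [TopologicalSpace X] [TopologicalSpace E']
  [TopologicalSpace X'] {G G' : Type*} [Group G] [MulAction G E] [AddGroup G'] [AddAction G' E']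
  {p : E → X} {p' : E' → X'}

/-- **Mixed form** (the shape of a period / Albanese map: a discrete group `G` of automorphisms of a
simply connected domain `E` upstairs, a lattice `G'` acting by translations on a vector space `E'`): a
map `φ : X → X'` covered by `φ̃ : E → E'` with `φ̃ (g • z) = τ g +ᵥ φ̃ z` and `τ : G → G'` ONTO is onto on
`π₁`. [cite: HatcherAT2002, Prop. 1.39 and Prop. 1.40] -/
theorem surjective_map_of_equivariant_vadd [PathConnectedSpace E] [SimplyConnectedSpace E']
    (hp : IsQuotientCoveringMap p G) (hp' : IsAddQuotientCoveringMap p' G') (φt : C(E, E'))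
    (φ : C(X, X')) (τ : G → G') (hτ : Surjective τ) (hover : ∀ z, p' (φt z) = φ (p z))
    (hequiv : ∀ (g : G) (z : E), φt (g • z) = τ g +ᵥ φt z) (e : E) :
    Surjective (FundamentalGroup.map φ (p e)) :=
  surjective_map_of_equivariant hp hp'.toMultiplicative φt φ (fun g ↦ Multiplicative.ofAdd (τ g))
    (fun g' ↦ by obtain ⟨g, hg⟩ := hτ g'.toAdd; exact ⟨g, by simp [hg]⟩)
    hover (fun g z ↦ hequiv g z) e

/-- Mixed form, `mapOfEq` version at a prescribed base point `p' e'`, `φ̃ e = e'`.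
[cite: HatcherAT2002, Prop. 1.39 and Prop. 1.40] -/
theorem surjective_mapOfEq_of_equivariant_vadd [PathConnectedSpace E] [SimplyConnectedSpace E']
    (hp : IsQuotientCoveringMap p G) (hp' : IsAddQuotientCoveringMap p' G') (φt : C(E, E'))
    (φ : C(X, X')) (τ : G → G') (hτ : Surjective τ) (hover : ∀ z, p' (φt z) = φ (p z))
    (hequiv : ∀ (g : G) (z : E), φt (g • z) = τ g +ᵥ φt z) (e : E) {e' : E'} (he : φt e = e') :
    Surjective (FundamentalGroup.mapOfEq φ (show φ (p e) = p' e' by rw [← hover, he])) :=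
  surjective_mapOfEq_of_equivariant hp hp'.toMultiplicative φt φ (fun g ↦ Multiplicative.ofAdd (τ g))
    (fun g' ↦ by obtain ⟨g, hg⟩ := hτ g'.toAdd; exact ⟨g, by simp [hg]⟩)
    hover (fun g z ↦ hequiv g z) e he

/-- Mixed form: `φ_*` is onto iff `τ` is. [cite: HatcherAT2002, Prop. 1.39 and Prop. 1.40] -/
theorem surjective_map_iff_of_equivariant_vadd [PathConnectedSpace E] [SimplyConnectedSpace E']
    (hp : IsQuotientCoveringMap p G) (hp' : IsAddQuotientCoveringMap p' G') (φt : C(E, E'))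
    (φ : C(X, X')) (τ : G → G') (hover : ∀ z, p' (φt z) = φ (p z))
    (hequiv : ∀ (g : G) (z : E), φt (g • z) = τ g +ᵥ φt z) (e : E) :
    Surjective (FundamentalGroup.map φ (p e)) ↔ Surjective τ := by
  have h := surjective_mapOfEq_iff_of_equivariant hp hp'.toMultiplicative φt φ
    (fun g ↦ Multiplicative.ofAdd (τ g)) hover (fun g z ↦ hequiv g z) e rfl
  -- move the base point `p' (φ̃ e)` of `mapOfEq` to `φ (p e)` of `map`
  have h1 : ∀ {y : X'} (hy : φ (p e) = y), Surjective (FundamentalGroup.map φ (p e)) ↔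
      Surjective (FundamentalGroup.mapOfEq φ hy) := by
    intro y hy
    subst hy
    exact ⟨fun hs δ ↦ by obtain ⟨γ, hγ⟩ := hs δ; exact ⟨γ, by rw [mapOfEq_rfl_apply, hγ]⟩,
      fun hs δ ↦ by obtain ⟨γ, hγ⟩ := hs δ; exact ⟨γ, by rw [← mapOfEq_rfl_apply, hγ]⟩⟩
  have h2 : Surjective (fun g ↦ Multiplicative.ofAdd (τ g)) ↔ Surjective τ :=
    Multiplicative.ofAdd.surjective_comp τ
  exact (h1 _).trans (h.trans h2)

/-- Mixed form, index shape: `[π₁(X', φ (p e)) : φ_* π₁(X, p e)] = 1`.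
[cite: HatcherAT2002, Prop. 1.39 and Prop. 1.40] -/
theorem index_range_map_eq_one_of_equivariant_vadd [PathConnectedSpace E] [SimplyConnectedSpace E']
    (hp : IsQuotientCoveringMap p G) (hp' : IsAddQuotientCoveringMap p' G') (φt : C(E, E'))
    (φ : C(X, X')) (τ : G → G') (hτ : Surjective τ) (hover : ∀ z, p' (φt z) = φ (p z))
    (hequiv : ∀ (g : G) (z : E), φt (g • z) = τ g +ᵥ φt z) (e : E) :
    (FundamentalGroup.map φ (p e)).range.index = 1 := by
  rw [MonoidHom.range_eq_top.2 (surjective_map_of_equivariant_vadd hp hp' φt φ τ hτ hover hequiv e),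
    Subgroup.index_top]

end MulAdd

/-! ### Consequence on `H¹` with field coefficients -/

section Cohomology

variable {E E' : Type*} {X X' : Type u} [TopologicalSpace E] [TopologicalSpace X] [TopologicalSpace E']
  [TopologicalSpace X']

/-- The base of a quotient covering with path-connected total space is path connected. [folklore] -/
private theorem pathConnectedSpace_of_isQuotientCoveringMap {G' : Type*} [Group G'] [MulAction G' E']
    [PathConnectedSpace E'] {p' : E' → X'} (hp' : IsQuotientCoveringMap p' G') :
    PathConnectedSpace X' := by
  rw [pathConnectedSpace_iff_univ, ← hp'.surjective.range_eq, ← Set.image_univ]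
  exact (pathConnectedSpace_iff_univ.1 inferInstance).image' hp'.continuous.continuousOn

/-- **`φ^* : H¹(X'; F) → H¹(X; F)` is injective** for a map `φ` covered by a `τ`-equivariant lift
between quotient coverings with `τ` onto (`E` path connected, `E'` simply connected) and `F` a field of
characteristic zero: `φ_*` is onto on `π₁`, hence onto on `H₁(·; F)` (loop classes span, Hatcher
Thm. 2A.1), and `φ^*` on `H¹` is the transpose. [cite: HatcherAT2002, Thm. 2A.1 and §3.1 p. 198] -/
theorem injective_singularCohomology_map_one_of_equivariant {G G' : Type*} [Group G] [MulAction G E]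
    [Group G'] [MulAction G' E'] {p : E → X} {p' : E' → X'} [PathConnectedSpace E]
    [SimplyConnectedSpace E'] (F : Type v) [Field F] [CharZero F]
    (hp : IsQuotientCoveringMap p G) (hp' : IsQuotientCoveringMap p' G') (φt : C(E, E')) (φ : C(X, X'))
    (τ : G → G') (hτ : Surjective τ) (hover : ∀ z, p' (φt z) = φ (p z))
    (hequiv : ∀ (g : G) (z : E), φt (g • z) = τ g • φt z) (e : E) :
    Injective (singularCohomology.map F F φ 1) := by
  haveI : PathConnectedSpace X' := pathConnectedSpace_of_isQuotientCoveringMap hp'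
  refine (singularCohomology_map_injective_iff_of_field F φ 1).mpr
    (singularHomology.map_one_surjective_of_index_ne_zero (Y := X') F φ (p e) ?_)
  rw [index_range_map_eq_one_of_equivariant hp hp' φt φ τ hτ hover hequiv e]
  exact one_ne_zero

/-- Mixed form of `injective_singularCohomology_map_one_of_equivariant` (multiplicative group upstairs,
additive group — a lattice of translations — on the target). [cite: HatcherAT2002, Thm. 2A.1 and §3.1 p. 198] -/
theorem injective_singularCohomology_map_one_of_equivariant_vadd {G G' : Type*} [Group G]
    [MulAction G E] [AddGroup G'] [AddAction G' E'] {p : E → X} {p' : E' → X'} [PathConnectedSpace E]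
    [SimplyConnectedSpace E'] (F : Type v) [Field F] [CharZero F]
    (hp : IsQuotientCoveringMap p G) (hp' : IsAddQuotientCoveringMap p' G') (φt : C(E, E'))
    (φ : C(X, X')) (τ : G → G') (hτ : Surjective τ) (hover : ∀ z, p' (φt z) = φ (p z))
    (hequiv : ∀ (g : G) (z : E), φt (g • z) = τ g +ᵥ φt z) (e : E) :
    Injective (singularCohomology.map F F φ 1) :=
  injective_singularCohomology_map_one_of_equivariant F hp hp'.toMultiplicative φt φ
    (fun g ↦ Multiplicative.ofAdd (τ g))
    (fun g' ↦ by obtain ⟨g, hg⟩ := hτ g'.toAdd; exact ⟨g, by simp [hg]⟩)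
    hover (fun g z ↦ hequiv g z) e

/-- Additive form of `injective_singularCohomology_map_one_of_equivariant`.
[cite: HatcherAT2002, Thm. 2A.1 and §3.1 p. 198] -/
theorem injective_singularCohomology_map_one_of_equivariant_add {G G' : Type*} [AddGroup G]
    [AddAction G E] [AddGroup G'] [AddAction G' E'] {p : E → X} {p' : E' → X'} [PathConnectedSpace E]
    [SimplyConnectedSpace E'] (F : Type v) [Field F] [CharZero F]
    (hp : IsAddQuotientCoveringMap p G) (hp' : IsAddQuotientCoveringMap p' G') (φt : C(E, E'))
    (φ : C(X, X')) (τ : G → G') (hτ : Surjective τ) (hover : ∀ z, p' (φt z) = φ (p z))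
    (hequiv : ∀ (g : G) (z : E), φt (g +ᵥ z) = τ g +ᵥ φt z) (e : E) :
    Injective (singularCohomology.map F F φ 1) :=
  injective_singularCohomology_map_one_of_equivariant F hp.toMultiplicative hp'.toMultiplicative φt φ
    (fun g ↦ Multiplicative.ofAdd (τ g.toAdd))
    (fun g' ↦ by obtain ⟨g, hg⟩ := hτ g'.toAdd; exact ⟨Multiplicative.ofAdd g, by simp [hg]⟩)
    hover (fun g z ↦ hequiv g.toAdd z) e

end Cohomology

end Literature.AlgebraicTopology.FundamentalGroup

end
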